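import Mathlib
import Summits.KontsevichZagierPeriods.Zeta5Search.Certificates.RecordRayMirror
import Summits.KontsevichZagierPeriods.Zeta5Search.Certificates.RayC1GenericSteps
import HarnessLib

/-!
# A computable mirror of the C1 period matrix and its window determinant mod 193 (fam-tele g17, S4-C1 LITE file L4)

HONEST FRAMING: systematic search; no irrationality claim unless certified.  Finite exact arithmetic in `ℤ/193`; nothing
here is a statement about `ζ(5)`; C1 is the calibration ray, every exponent attached to it in the tree is `< 1`.

The C1 copy of the ray-specific half of `RecordRayMirror`: the nine-field mirror `M3` (with `mul/adj/det/chain` and the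
exactness lemmas `M3.toMatrix_*`), `hTildeM` and `windowM` are the record file's, imported by name; here the mirrors
`matAM/matBM/prodAM/prodBM/PgenM/DwinM` of the C1 period data of `RayC1GenericSteps` (106 raises; 42 diagonal shifts then
`H`; `Pgen = adj(prodA)·prodB`) and their agreement with the `Matrix` side (`toMatrix_PgenM`).  The ONE computation of the
(N ∃ᶠ) half of S4-C1: `DwinM_mod193` — the window determinant `D(ν)` at `ν = 1 ∈ ℤ/193` is nonzero (`decide`, kernel); the
modulus is the smallest prime at which `D(1)` does not vanish (fam-tele g17 `c1prep/RESULTS-gcd-modp.json`: every prime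
`< 193` divides `D(1)`, forced zeros of the large smooth integer factors, exactly as `97` was the first good prime for the
record ray).  Hence `D(n) ≠ 0` for every `n ≡ 1 (mod 193)` (`RayC1Window.Dwin_ne_of_mod`).
-/

namespace Summit.KontsevichZagierPeriods.Zeta5Search.RayC1.Generic

open Matrix
open Summit.KontsevichZagierPeriods.Zeta5Search.RecordRay.Generic (M3 hTildeM windowM toMatrix_hTildeM dsMatG)

section Mirror

variable {R : Type*} [CommRing R]

/-- Mirror of `matA` (C1). -/
def matAM (ν : R) (k : ℕ) : M3 R := M3.ofMatrix (matA ν k)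

/-- Mirror of `matB` (C1: `D̃S` for `k < 42`, `H̃` at `k = 42`). -/
def matBM (ν : R) (k : ℕ) : M3 R :=
  if k = 42 then hTildeM (c1PtG (betaB 42) ν) else M3.ofMatrix (dsMatG (c1PtG (betaB k) ν))

/-- Mirror of `prodA` (106 factors). -/
def prodAM (ν : R) : M3 R := M3.chain (matAM ν) 106
/-- Mirror of `prodB` (43 factors). -/
def prodBM (ν : R) : M3 R := M3.chain (matBM ν) 43
/-- Mirror of the C1 connection matrix `Pgen = adj(prodA)·prodB`. -/
def PgenM (ν : R) : M3 R := (prodAM ν).adj.mul (prodBM ν)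

/-- The window determinant `D(ν)` of the C1 ray, computably. -/
def DwinM (ν : R) : R := (windowM (PgenM ν) (PgenM (ν + 1))).det

/-- The mirror A-step agrees with `matA`. -/
theorem toMatrix_matAM (ν : R) (k : ℕ) : (matAM ν k).toMatrix = matA ν k := M3.toMatrix_ofMatrix _

/-- The mirror B-step agrees with `matB`. -/
theorem toMatrix_matBM (ν : R) (k : ℕ) : (matBM ν k).toMatrix = matB ν k := by
  unfold matBM matB
  split_ifs
  exacts [toMatrix_hTildeM _, M3.toMatrix_ofMatrix _]

/-- The mirror A-product agrees with `prodA`. -/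
theorem toMatrix_prodAM (ν : R) : (prodAM ν).toMatrix = prodA ν := by
  rw [prodAM, M3.toMatrix_chain, prodA]
  simp only [toMatrix_matAM]

/-- The mirror B-product agrees with `prodB`. -/
theorem toMatrix_prodBM (ν : R) : (prodBM ν).toMatrix = prodB ν := by
  rw [prodBM, M3.toMatrix_chain, prodB]
  simp only [toMatrix_matBM]

/-- The mirror connection matrix agrees with `Pgen`. -/
theorem toMatrix_PgenM (ν : R) : (PgenM ν).toMatrix = Pgen ν := by
  rw [PgenM, M3.toMatrix_mul, M3.toMatrix_adj, toMatrix_prodAM, toMatrix_prodBM, Pgen]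

end Mirror

/-! ### The computation -/

/-- **The one computation of the (N ∃ᶠ) half of S4-C1 (kernel `decide`).**  The window determinant of the integer period
matrices of the C1 ray at `ν = 1 ∈ ℤ/193` is nonzero (its value is `94`); hence `D(n) ≠ 0` for every `n ≡ 1 (mod 193)`
(`RayC1Window.Dwin_ne_of_mod`).  `193` is the least prime not dividing the integer `D(1)`. -/
theorem DwinM_mod193 : DwinM (1 : ZMod 193) ≠ 0 := by decide +kernel

end Summit.KontsevichZagierPeriods.Zeta5Search.RayC1.Generic
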